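import Summits.QuantumAdvantage.AdviceFreeQNC0.R1OneFibre39
import Summits.QuantumAdvantage.AdviceFreeQNC0.AffBells23Transversal
import HarnessLib

/-!
# Cell qa-qnc0, `p = 3` — (R1) UP TO THE PAIR MASS of the outside reads (Turán transversal + fibre method), and (R1) for
# BOUNDED READ MULTIPLICITY, every `C` (prover qn-prover-3 g25; sequel of `R1OneFibre39.lean`)

`AffBells22.norm_twistedWinSum_le_of_transversal` (fibre method) bounds the twisted odd-class win sum of a strategy whose bell `k` reads
`T k` by `2·(39/40)^{#A}·2^N` for every transversal `A ⊆ supp β` of the reading sets.  The tree's Caro–Wei/Turán lemma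
`AffBells23.exists_transversal` (planner p1 g23, for LEMMA JPD) supplies, inside `P = supp β ∖ W`, a transversal of the OUTSIDE reads
`S k = T k ∖ W` of size `≥ #P² / (#P + Λ)`, `Λ = Σ_k #(S k ∩ P)·(#(S k ∩ P) − 1)` = the twisted PAIR MASS of the outside reads.  Hence:

* **`AffBells22.norm_twistedWinSum_le_pairMass`** — `‖Σ_x e₃(β·x)[OddZeros x ∧ Rel x (g x)]‖ ≤ 2·(39/40)^{#P²/(#P + Λ)}·2^N` for EVERY `W`
  and EVERY family of reading sets (`N ≥ 3`); `Λ = 0` (each bell reads `≤ 1` twisted outside letter) is `R1One`;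
* **`AffBells22.norm_twistedWinSum_le_of_readMultiplicity`** — if `#(T k ∖ W) ≤ s` and every letter outside `W` is read (outside `W`)
  by at most `m` bells, then `Λ ≤ (s − 1)·m·#P` and the bound is `2·(39/40)^{#P/(s·m)}·2^N`;
* **`GradedSeeds38.twistedJuntaBoundX3S_of_readMultiplicity`** — for every `m ≥ 1`: the statement of (R1)
  `TwistedJunta36.TwistedJuntaBoundX3S` VERBATIM with `ρ = ρ_m := (39/40)^{1/m} < 1` and the one extra hypothesis that every letter
  outside `W` lies in at most `m` of the sets `T k ∖ W` (every `C`; `A = 1`, `n₀ = 3`; `3·#W ≤ N` unused).  Since the consumer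
  `gradedJuntaReductionS` accepts any `ρ < 1`, (R1) is thereby SETTLED for outside reads of bounded multiplicity.

So the open content of (R1) is confined to outside-read families whose twisted pair mass is `≫ (log₂N)^C · #P`, i.e. unbounded read
multiplicity with dense pairwise overlaps (pair-covering families; planner p1's Claim K regime, ROUND-38 §6.2; p2 ROUND-38P2 §9) — on each
kernel-line fibre this is "random hard-core sub-sums of a polylog-degree 𝔽₂-polynomial versus a MOD₃ character".

WHAT THIS IS NOT: nothing on the dense-overlap regime; crux `stmt-QuantumAdvantage-22907` untouched.
-/

noncomputable section

namespace Summit.QuantumAdvantage.AdviceFreeQNC0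

open Finset Literature.Computability.QuantumComplexity Literature.Computability.QuantumComplexity.RingHLF
open Literature.Computability.MetaComplexity
open scoped Classical

namespace AffBells22

variable {N : ℕ}

/-- `c·(c − 1)` cast to `ℝ` (natural subtraction is harmless: the term vanishes at `c = 0`). -/
theorem cast_mul_pred_eq (c : ℕ) : (((c * (c - 1) : ℕ)) : ℝ) = (c : ℝ) * ((c : ℝ) - 1) := by
  rcases Nat.eq_zero_or_pos c with rfl | hpos
  · simp
  · rw [Nat.cast_mul, Nat.cast_sub hpos]; push_cast; ring

/-- **(R1) UP TO THE PAIR MASS** (fibre method + Turán transversal).  Bell `k` reads `T k`; `P = supp β ∖ W` (twisted letters outside an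
ARBITRARY set `W`); `Λ = Σ_k c_k (c_k − 1)` with `c_k = #((T k ∖ W) ∩ P)` (twisted pair mass of the outside reads).  Then
`‖Σ_x e₃(β·x)[OddZeros x ∧ Rel x (g x)]‖ ≤ 2 · (39/40)^{#P² / (#P + Λ)} · 2^N` (`N ≥ 3`). -/
theorem norm_twistedWinSum_le_pairMass (hN : 3 ≤ N) (W : Finset (Fin N)) (T : Fin N → Finset (Fin N))
    (g : Fin N → (Fin N → Bool) → Bool) (hg : ∀ k, ReadsOnly (T k) (g k)) (β : Fin N → ZMod 3) :
    ‖∑ x : Fin N → Bool, (ZMod.stdAddChar (∑ i : Fin N, if x i then β i else 0) : ℂ) *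
        (if (OddZeros x ∧ RingHLF.Rel x (fun k => g k x)) then (1 : ℂ) else 0)‖
      ≤ 2 * (39 / 40 : ℝ) ^
          ((univ.filter fun j : Fin N => j ∉ W ∧ β j ≠ 0).card ^ 2 /
            ((univ.filter fun j : Fin N => j ∉ W ∧ β j ≠ 0).card +
              ∑ k : Fin N, ((T k \ W) ∩ univ.filter (fun j : Fin N => j ∉ W ∧ β j ≠ 0)).card *
                (((T k \ W) ∩ univ.filter (fun j : Fin N => j ∉ W ∧ β j ≠ 0)).card - 1)))
        * (2 : ℝ) ^ N := by
  classical
  set P := univ.filter (fun j : Fin N => j ∉ W ∧ β j ≠ 0) with hPdef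
  set Λ := ∑ k : Fin N, ((T k \ W) ∩ P).card * (((T k \ W) ∩ P).card - 1) with hΛdef
  obtain ⟨A, hAP, hA1, hsq⟩ := AffBells23.exists_transversal (univ : Finset (Fin N)) (fun k => T k \ W) P
  -- the transversal of the outside reads is a transversal of the reads (it avoids `W`)
  have hA : ∀ k, (T k ∩ A).card ≤ 1 := by
    intro k
    have hsub : T k ∩ A ⊆ (T k \ W) ∩ A := by
      intro j hj
      rw [mem_inter] at hj
      exact mem_inter.mpr ⟨mem_sdiff.mpr ⟨hj.1, (mem_filter.mp (hAP hj.2)).2.1⟩, hj.2⟩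
    exact (card_le_card hsub).trans (hA1 k (mem_univ _))
  have hAβ : ∀ j ∈ A, β j ≠ 0 := fun j hj => (mem_filter.mp (hAP hj)).2.2
  refine (norm_twistedWinSum_le_of_transversal hN T g hg β A hA hAβ).trans ?_
  -- `#P² ≤ #A · (#P + Λ)` in `ℕ`, from the real inequality of `exists_transversal`
  have hsqN : P.card ^ 2 ≤ A.card * (P.card + Λ) := by
    have hcast : (∑ k : Fin N, (((T k \ W) ∩ P).card : ℝ) * ((((T k \ W) ∩ P).card : ℝ) - 1)) = (Λ : ℝ) := by
      rw [hΛdef, Nat.cast_sum]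
      exact sum_congr rfl fun k _ => (cast_mul_pred_eq _).symm
    have h : ((P.card : ℝ)) ^ 2 ≤ (A.card : ℝ) * ((P.card : ℝ) + (Λ : ℝ)) := by rw [← hcast]; exact hsq
    exact_mod_cast h
  have hdiv : P.card ^ 2 / (P.card + Λ) ≤ A.card := by
    rcases Nat.eq_zero_or_pos (P.card + Λ) with h0 | hpos
    · rw [h0, Nat.div_zero]; exact Nat.zero_le _
    · exact (Nat.div_le_iff_le_mul_add_pred hpos).mpr (by nlinarith [hsqN])
  have hpow : (39 / 40 : ℝ) ^ A.card ≤ (39 / 40 : ℝ) ^ (P.card ^ 2 / (P.card + Λ)) :=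
    pow_le_pow_of_le_one (by norm_num) (by norm_num) hdiv
  have h2 : (0 : ℝ) ≤ (2 : ℝ) ^ N := by positivity
  nlinarith [hpow, h2]

/-- **(R1) for BOUNDED READ MULTIPLICITY.**  If `#(T k ∖ W) ≤ s` (`s ≥ 1`) and every letter outside `W` lies in at most `m ≥ 1` of the
sets `T k ∖ W`, then the twisted pair mass is `≤ (s−1)·m·#P` and `‖Σ_x e₃(β·x)[OddZeros x ∧ Rel x (g x)]‖ ≤ 2·(39/40)^{#P/(s·m)}·2^N`. -/
theorem norm_twistedWinSum_le_of_readMultiplicity (hN : 3 ≤ N) {s m : ℕ} (hs : 1 ≤ s) (hm : 1 ≤ m) (W : Finset (Fin N))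
    (T : Fin N → Finset (Fin N)) (g : Fin N → (Fin N → Bool) → Bool) (hg : ∀ k, ReadsOnly (T k) (g k))
    (hTs : ∀ k, (T k \ W).card ≤ s) (hmult : ∀ j : Fin N, j ∉ W → (univ.filter fun k : Fin N => j ∈ T k \ W).card ≤ m)
    (β : Fin N → ZMod 3) :
    ‖∑ x : Fin N → Bool, (ZMod.stdAddChar (∑ i : Fin N, if x i then β i else 0) : ℂ) *
        (if (OddZeros x ∧ RingHLF.Rel x (fun k => g k x)) then (1 : ℂ) else 0)‖
      ≤ 2 * (39 / 40 : ℝ) ^ ((univ.filter fun j : Fin N => j ∉ W ∧ β j ≠ 0).card / (s * m)) * (2 : ℝ) ^ N := by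
  classical
  set P := univ.filter (fun j : Fin N => j ∉ W ∧ β j ≠ 0) with hPdef
  set c : Fin N → ℕ := fun k => ((T k \ W) ∩ P).card with hcdef
  set Λ := ∑ k : Fin N, c k * (c k - 1) with hΛdef
  -- pair mass ≤ (s−1)·m·#P : double counting of the incidences (k, j), j ∈ (T k ∖ W) ∩ P
  have hinc : ∑ k : Fin N, c k ≤ m * P.card := by
    have hswap : ∑ k : Fin N, c k = ∑ j ∈ P, (univ.filter fun k : Fin N => j ∈ T k \ W).card := by
      simp only [hcdef]
      rw [show (∑ k : Fin N, ((T k \ W) ∩ P).card) = ∑ k : Fin N, ∑ j ∈ P, (if j ∈ T k \ W then 1 else 0) from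
        sum_congr rfl fun k _ => by rw [← card_filter, filter_mem_eq_inter, inter_comm]]
      rw [sum_comm]
      exact sum_congr rfl fun j _ => by rw [card_filter]
    rw [hswap]
    calc ∑ j ∈ P, (univ.filter fun k : Fin N => j ∈ T k \ W).card ≤ ∑ _j ∈ P, m :=
          sum_le_sum fun j hj => hmult j (mem_filter.mp hj).2.1
      _ = m * P.card := by rw [sum_const, smul_eq_mul, mul_comm]
  have hΛ : Λ ≤ (s - 1) * (m * P.card) := by
    calc Λ = ∑ k : Fin N, c k * (c k - 1) := rfl
      _ ≤ ∑ k : Fin N, c k * (s - 1) := sum_le_sum fun k _ => Nat.mul_le_mul_left _ (by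
          have : c k ≤ s := (card_le_card inter_subset_left).trans (hTs k)
          omega)
      _ = (∑ k : Fin N, c k) * (s - 1) := by rw [sum_mul]
      _ ≤ (m * P.card) * (s - 1) := Nat.mul_le_mul_right _ hinc
      _ = (s - 1) * (m * P.card) := by ring
  have hmain := norm_twistedWinSum_le_pairMass hN W T g hg β
  refine hmain.trans ?_
  -- exponent comparison: #P/(s m) ≤ #P²/(#P + Λ)
  have hexp : P.card / (s * m) ≤ P.card ^ 2 / (P.card + Λ) := by
    rcases Nat.eq_zero_or_pos P.card with h0 | hPpos
    · rw [h0]; simp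
    · have hden : P.card + Λ ≤ P.card * (s * m) := by
        have h1 : 1 + (s - 1) * m ≤ s * m := by
          obtain ⟨s', rfl⟩ : ∃ s', s = s' + 1 := ⟨s - 1, by omega⟩
          rw [Nat.add_sub_cancel]
          nlinarith
        calc P.card + Λ ≤ P.card + (s - 1) * (m * P.card) := by omega
          _ = P.card * (1 + (s - 1) * m) := by ring
          _ ≤ P.card * (s * m) := Nat.mul_le_mul_left _ h1
      have hsm : 0 < s * m := Nat.mul_pos (by omega) (by omega)
      calc P.card / (s * m) = P.card * P.card / (P.card * (s * m)) := by
            rw [Nat.mul_div_mul_left _ _ hPpos]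
        _ ≤ P.card * P.card / (P.card + Λ) := Nat.div_le_div_left hden (by omega)
        _ = P.card ^ 2 / (P.card + Λ) := by rw [sq]
  have hpow : (39 / 40 : ℝ) ^ (P.card ^ 2 / (P.card + Λ)) ≤ (39 / 40 : ℝ) ^ (P.card / (s * m)) :=
    pow_le_pow_of_le_one (by norm_num) (by norm_num) hexp
  have h2 : (0 : ℝ) ≤ (2 : ℝ) ^ N := by positivity
  nlinarith [hpow, h2]

end AffBells22

namespace GradedSeeds38

open AffBells22

/-- The rate `ρ_m = (39/40)^{1/m}`. -/
theorem rho_pow_inv_lt_one {m : ℕ} (hm : 1 ≤ m) : (39 / 40 : ℝ) ^ ((1 : ℝ) / m) < 1 :=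
  Real.rpow_lt_one (by norm_num) (by norm_num) (by positivity)

/-- `ρ_m ≥ 0`. -/
theorem rho_pow_inv_nonneg (m : ℕ) : 0 ≤ (39 / 40 : ℝ) ^ ((1 : ℝ) / m) :=
  Real.rpow_nonneg (by norm_num) _

/-- `(39/40)^{⌊q/m⌋} ≤ (40/39) · ρ_m^q` (integer division loses at most one factor `ρ_m^m = 39/40`). -/
theorem pow_div_le_rho_pow {m : ℕ} (hm : 1 ≤ m) (q : ℕ) :
    (39 / 40 : ℝ) ^ (q / m) ≤ 40 / 39 * ((39 / 40 : ℝ) ^ ((1 : ℝ) / m)) ^ q := by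
  have hρ : (0 : ℝ) < 39 / 40 := by norm_num
  -- `ρ_m^q = (39/40)^{q/m}` (real exponent) and `⌊q/m⌋ ≥ q/m − 1`
  have h1 : ((39 / 40 : ℝ) ^ ((1 : ℝ) / m)) ^ q = (39 / 40 : ℝ) ^ ((q : ℝ) / m) := by
    rw [← Real.rpow_natCast, ← Real.rpow_mul hρ.le]
    congr 1
    field_simp
  rw [h1]
  have hdiv : ((q : ℝ) / m) - 1 ≤ ((q / m : ℕ) : ℝ) := by
    have hm' : (0 : ℝ) < m := by exact_mod_cast (show 0 < m by omega)
    have hq : (q : ℝ) < ((q / m : ℕ) : ℝ) * m + m := by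
      have := Nat.lt_div_mul_add (a := q) (show 0 < m by omega)
      exact_mod_cast this
    have : (q : ℝ) / m < ((q / m : ℕ) : ℝ) + 1 := by
      rw [div_lt_iff₀ hm']; linarith
    linarith
  have hle : (39 / 40 : ℝ) ^ (((q / m : ℕ)) : ℝ) ≤ (39 / 40 : ℝ) ^ (((q : ℝ) / m) - 1) :=
    Real.rpow_le_rpow_of_exponent_ge hρ (by norm_num) hdiv
  rw [Real.rpow_natCast] at hle
  refine hle.trans (le_of_eq ?_)
  rw [Real.rpow_sub hρ, Real.rpow_one]
  ring

/-- **(R1) `TwistedJunta36.TwistedJuntaBoundX3S` for outside reads of BOUNDED MULTIPLICITY `m`** — the statement of (R1) verbatim with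
`ρ = ρ_m = (39/40)^{1/m}` (`0 ≤ ρ_m < 1`: `rho_pow_inv_nonneg`, `rho_pow_inv_lt_one`) and the single extra hypothesis that every letter
outside `W` lies in at most `m` of the outside-read sets `T k ∖ W` (every `C`; `A = 1`, `n₀ = 3`; `3·#W ≤ N` unused). -/
theorem twistedJuntaBoundX3S_of_readMultiplicity {m : ℕ} (hm : 1 ≤ m) (C : ℕ) :
    ∃ A n₀ : ℕ, ∀ N ≥ n₀,
      ∀ (W : Finset (Fin N)) (T : Fin N → Finset (Fin N)) (g : Fin N → (Fin N → Bool) → Bool),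
        3 * W.card ≤ N → (∀ k, (T k \ W).card ≤ (Nat.log 2 N) ^ C) →
        (∀ j : Fin N, j ∉ W → (univ.filter fun k : Fin N => j ∈ T k \ W).card ≤ m) →
        (∀ k (x x' : Fin N → Bool), (∀ i ∈ T k, x i = x' i) → g k x = g k x') →
          ∀ β : Fin N → ZMod 3,
            ‖∑ x : Fin N → Bool, (ZMod.stdAddChar (∑ i : Fin N, if x i then β i else 0) : ℂ) *
                (if (OddZeros x ∧ RingHLF.Rel x (fun k => g k x)) then (1 : ℂ) else 0)‖
              ≤ (N : ℝ) ^ A * ((39 / 40 : ℝ) ^ ((1 : ℝ) / m)) ^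
                    ((univ.filter fun i : Fin N => i ∉ W ∧ β i ≠ 0).card / (Nat.log 2 N) ^ C)
                  * (2 : ℝ) ^ N := by
  classical
  refine ⟨1, 3, fun N hN W T g _hW hT hmult hg β => ?_⟩
  have hlog : 1 ≤ Nat.log 2 N := Nat.le_log_of_pow_le (by norm_num) (by omega)
  have hs : 1 ≤ (Nat.log 2 N) ^ C := Nat.one_le_pow _ _ hlog
  have hTr : ∀ k, ReadsOnly (T k) (g k) := fun k x x' h => hg k x x' h
  have h := norm_twistedWinSum_le_of_readMultiplicity hN hs hm W T g hTr hT hmult β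
  set P := univ.filter (fun j : Fin N => j ∉ W ∧ β j ≠ 0) with hPdef
  set s := (Nat.log 2 N) ^ C with hsdef
  rw [pow_one]
  refine h.trans ?_
  have hqm : P.card / (s * m) = (P.card / s) / m := (Nat.div_div_eq_div_mul _ _ _).symm
  rw [hqm]
  have hρ := pow_div_le_rho_pow hm (P.card / s)
  have hN3 : (3 : ℝ) ≤ (N : ℝ) := by exact_mod_cast hN
  have h2 : (0 : ℝ) ≤ (2 : ℝ) ^ N := by positivity
  have hρq : (0 : ℝ) ≤ ((39 / 40 : ℝ) ^ ((1 : ℝ) / m)) ^ (P.card / s) := pow_nonneg (rho_pow_inv_nonneg m) _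
  have hX2 : (0 : ℝ) ≤ ((39 / 40 : ℝ) ^ ((1 : ℝ) / m)) ^ (P.card / s) * (2 : ℝ) ^ N := mul_nonneg hρq h2
  calc 2 * (39 / 40 : ℝ) ^ (P.card / s / m) * (2 : ℝ) ^ N
      ≤ 2 * (40 / 39 * ((39 / 40 : ℝ) ^ ((1 : ℝ) / m)) ^ (P.card / s)) * (2 : ℝ) ^ N := by gcongr
    _ = 80 / 39 * (((39 / 40 : ℝ) ^ ((1 : ℝ) / m)) ^ (P.card / s) * (2 : ℝ) ^ N) := by ring
    _ ≤ (N : ℝ) * (((39 / 40 : ℝ) ^ ((1 : ℝ) / m)) ^ (P.card / s) * (2 : ℝ) ^ N) :=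
        mul_le_mul_of_nonneg_right (by linarith) hX2
    _ = (N : ℝ) * ((39 / 40 : ℝ) ^ ((1 : ℝ) / m)) ^ (P.card / s) * (2 : ℝ) ^ N := by ring

end GradedSeeds38

end Summit.QuantumAdvantage.AdviceFreeQNC0

end
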